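import Summits.QuantumFields.YangMills.Theorems.BalabanUVNodesN15TwoSpacingGluingCurvedKnitSmallFieldNodeFourAdjoint
import Summits.QuantumFields.YangMills.Theorems.BalabanUVNodesN15SmallFieldKnitConcrete
import HarnessLib

/-!
# N15 (NE2) — PROGRAMME ∂* «ADJOINT ENTRY», part (∂-1): n15-c∕180's OPERATOR LAYER WITH ENTRY 2 OF (3.42) IN THE PRINTED ADJOINT ARRANGEMENT `𝒢∘∇^{U*}`, MADE CONCRETE AND
# KNITTED INTO THE ROAD-(c) LITERAL — `sfE₄adj` (Σ-F's `sfE₄cov` with slot 2 re-pinned to n15-c∕180's displayed right-hand side), the operator layer EQUATION-FREE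
# (`ne2PlusOperator_sf₄adj`), the closed literal `sfObjects₄adj`, `Live ∧ N15At` at it, keyed ∕ family ∕ pinned faces

WHO ∕ WHEN.  Cell `pub-ymgap`, seat `pub-ymgap-dag-n15-a` (KNIT-BY-NAME seat of Track-A DAG node N15 = NE2, g31); `--supports stmt-QuantumFields-27366 --as helper` (K3⁸; count-neutral).
Two plumbing `def`s (`sfE₄adj`, `sfObjects₄adj`) + theorems.  Over n15-c∕180 `…TwoSpacingGluingCurvedKnitSmallFieldNodeFourAdjoint` (★★★ `ne2PlusOperator_sf₄_adj`, p717671) and Σ-F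
`…N15SmallFieldKnitConcrete` (`sfE₄cov`, `seven_le_blockFactor`; through it Σ-E `sfObjects`, `live_and_n15At_sf_of_ne2PlusOperator`, `live_sfObjects`, `s_N15_of_admits`) BY NAME; nothing
in the tree is modified; Σ-F's text with slot 2 re-pinned — exactly as n15-c∕180 is FILE 145's text with slot 2 re-pinned.

WHY.  [B9] Thm 3.1 lists the four operators of (3.42) as `G(U)`, `∇_UG(U)`, `G(U)∇*_U`, `Δ_UG(U)`: entry 2 is the propagator RIGHT-composed with the adjoint covariant derivative.  Σ-F's
literal `sfObjects₄cov` (the operator layer of this lane's three all-live literals (L-5) `sfObjects₄covAll`, (Ð-5) `sfObjects₄covLam`) carries in slot 2 a second FORWARD gradient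
`D^η_{R⁺_{μ₂}}𝒢` (FILE 145's arrangement, the one available on 2026-08-29 02:50Z).  n15-c∕180 (12:13Z) proved the operator layer with slot 2 := `𝒢∘D^η_{R⁻_{μ₂}}` along `τ_{μ₂}⁻¹` — for
unitary transports `(∇_U)* = −∇_U^{bwd}`, the print's `G∇*_U` — with rate exponent `γ = 1∕(16(d+1))`.  This file makes that entry assignment concrete once (so 180's three pinning equations
hold by `rfl`) and re-knits the closed road-(c) literal on it; (∂-2) re-knits the all-live torus and Dirichlet literals.  A v8 re-pin keyed to n15-c's family can now name a literal whose
operator layer has all four entries of (3.42) in the printed arrangement.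

WHAT.  §1 def `sfE₄adj d mm ι a e hL μ₁ μ₂ i : Fin 4 → (potential) → (operator)` := `![sfEntry0 …, <FILE 145∕180 entry 1 at μ₁>, <180's ADJOINT entry 2 at μ₂>, <entry 3>]` (slots 0, 1, 3 =
`sfE₄cov`'s letter for letter: `sfE₄adj_zero∕_one∕_three`, `rfl`); ★★★ `ne2PlusOperator_sf₄adj` (`NE2PlusOperator c₃₅ (sfInstance d mm ι hL) (fun i => sfFamily d mm ι a e hL i (sfE₄adj … i))`,
EQUATION-FREE = n15-c∕180 fed with `rfl rfl rfl`).  §2 def `sfObjects₄adj` (= Σ-E's `sfObjects … (sfE₄adj …) …`), `sfObjects₄adj_eq`, ★★★ **`live_and_n15At_sfObjects₄adj (hd) (hL) (hL7) (ha)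
(hc35) (he) (μ₁ μ₂) (haS) (α β p) : Live (…) ∧ N15At (ne2OfRecord₁₁ (sfObjects₄adj d mm ι a e hL μ₁ μ₂ c₃₅ p a_S α β))`** (the node's three conjuncts + dag-n15-w2's guard at a CLOSED
literal, operator layer NON-ABELIAN-live with the printed entry 2; SITE ∕ UNIT = Σ-E's U-blind genuine `U ≡ 1` kernels `siteOnS` ∕ `covOnS`), `n15At_sfObjects₄adj`, `live_sfObjects₄adj`; ★★
`s_N15_of_admits_sf₄adj` (part 30's keyed-home face).  §3 ★★ `live_and_n15At_sfObjects₄adj_family` (`(d, L) := (3, F.L)`) and the ROAD-(c) PINNED FACES under the pin BODY «∃ colour data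
`mm ι e` (trace-form-orthonormal), letters, ∀ F θ hP g₀ os k, (𝔯.lit …).ne2 k = sfObjects₄adj 3 mm ι a e F.hL …»: ★★ `keyedLive_of_pinnedSf₄adj`, ★★★ `live_and_n15At_rrOfRecord_of_pinnedSf₄adj`,
`n15At_lit_of_pinnedSf₄adj` (drop-ins; nothing registered, no re-pin asked).

HONEST FRAMING ∕ LIMITS.  Plumbing + by-name bookkeeping; NO estimate of this lane's; n15-c's MODEL caveats apply verbatim (global small-field gauge `u ≡ 1`; covariant Laplacian (3.50) ⊗
colour + FLAT nonlocal part (1.69) — NOT Bałaban's `Δ_a(U)` (3.26); C² window incl. all mixed second differences in place of (3.36) (`Reg336` idle); King-block-mean pairing; doubled-torus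
cover; `L ≥ 7`; crude constants, rate exponent `1∕(16(d+1))`); the η-RATE inequality itself is NOT PRINTED ([B9] Thm 3.14 = domain differences); SITE ∕ UNIT layers of THIS literal are the
U-blind genuine `U ≡ 1` kernels (the all-live editions are (∂-2)'s); `e` and the colour types stay parameters.  ref-B READ-989 items (i)(iii)(iv)(v)(vi) UNTOUCHED.  NOT [B9] Thms 3.1∕3.2∕3.15
AS PRINTED.  NOT the v7 pin's family; NO re-pin asked (road (b)∕(c) re-pins are the PLAN's; a re-pin keyed to THIS literal would fire FLAG №13 t2 by definition — the director's word, not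
mine); N15 stays DISCHARGED OF RECORD AS CONSUMED (U-blind v7 pin, p687738), nothing re-claimed, no count moved (typed 28∕28 · discharged 8∕28); K3⁸ OPEN; one finite 𝕋⁴ at fixed ε per
index — NOT ℝ⁴ ∕ infinite volume ∕ OS ∕ mass gap ∕ Clay.  Two plumbing `def`s ⇒ review ∕ audit lane.  Declared options: ONE `set_option maxHeartbeats 400000 in` (§1 ★★★) + `set_option maxRecDepth 4096 in` ×4
(§1 ★★★: the `rfl`s feeding 180's three pinning equations reduce `![…] n` under the large entry terms — Σ-F's budget verbatim).  No `sorry`, `instance`, `notation`; standard axioms.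
[cite: Balaban1985BackgroundPropagators, Thm 3.1 (3.42) p.397 (the four entries `G`, `∇_UG`, `G∇*_U`, `Δ_UG`; quantifier template), Thm 3.2 (3.48) p.398, Thm 3.15 (3.187) p.432, Thm 3.14 pp.426–427 (difference template), (3.50)–(3.53) p.400;
King1986, Lemma 4.5 (4.38) p.674 (A = 0 template), Prop. 3.9 (3.73) p.665 (rate factor)]
-/

noncomputable section

open scoped BigOperators Matrix Matrix.Norms.Frobenius

namespace Summit.QuantumFields.YangMills.BalabanUVNodes.N15.GenuineRecord

open Literature.MathematicalPhysics.QuantumFieldTheory.Balaban1983to89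
open Literature.MathematicalPhysics.QuantumFieldTheory.Balaban1983to89.T4Continuum (T4Family ULoop)
open Literature.MathematicalPhysics.QuantumFieldTheory.Balaban1983to89.T4EtaRate (PairedInstance EtaPairing NE2PlusOperator NE2PlusSite NE2PlusUnit)
open Literature.MathematicalPhysics.QuantumFieldTheory.Balaban1983to89.T4EtaRateDefect (idef)
open Literature.MathematicalPhysics.QuantumFieldTheory.Balaban1983to89.T4EtaRateCoeffDefect (pull)
open Literature.MathematicalPhysics.QuantumFieldTheory.Balaban1983to89.B5Prop11Plancherel (Tor fine)
open Literature.Barriers.QuantumFields (traceForm)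
open Node00 (Stage13HParams NE2Objects₁₁)
open Summit.QuantumFields.YangMills.BalabanUVNodes.N15.OperatorReadout (opGeo)
open Summit.QuantumFields.YangMills.BalabanUVNodes.N15.TwoGrid (TGIndex)
open Summit.QuantumFields.YangMills.BalabanUVNodes.N15.VectorPiece (bshiftEquiv kingPrV unitTorusGeoS)
open Summit.QuantumFields.YangMills.BalabanUVNodes.N15.MatrixSpecies (liftMap liftBlk coordMat covD)
open Summit.QuantumFields.YangMills.BalabanUVNodes.N15.BackgroundLayer (v1GaugeBg gavgM fineGeo bgInstanceM₂R covLapM)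
open Summit.QuantumFields.YangMills.BalabanUVNodes.N15.CurvedSpecies (gaugePair)
open Summit.QuantumFields.YangMills.BalabanUVNodes.N15.Gluing (SfIdx sfGeo sfInstance sfFamily sfEntry0 sfOps sfGaugeBg CvX CvX' cvM cvBlk cvGlued cvGlued' cvNL cvNL'
  ne2PlusOperator_sf₄_adj)
open Summit.QuantumFields.YangMills.BalabanUVNodes.N15.AtKeyedHome (s_N15_of_admits neZero_blockFactor)
open Summit.QuantumFields.YangMills.BalabanUVNodes.N15.PairedFamilyGuard (Live KeyedLive)
open YMDAG.UVSplit (N15At ne2OfRecord₁₁ RateReading₁₃CoPH rateCarriersOfRecord₁₃CoPH)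

variable (d : ℕ) {L : ℕ} [NeZero L] (mm ι : Type) [Fintype mm] [DecidableEq mm] [Fintype ι] [DecidableEq ι] (a : ℝ) (e : Matrix mm mm ℂ ≃L[ℝ] (ι → ℝ))

/-! ## §1 The concrete entry assignment with the printed entry 2, and the equation-free operator layer -/

/-- **THE ENTRY ASSIGNMENT OF n15-c∕180 MADE CONCRETE**: slot 0 = n15-c's `sfEntry0` (the η-defect of the live glued propagators), slot 1 = the η-defect of the COVARIANT forward gradient
`D^η_{R⁺_{μ₁}}𝒢` of the live glued pair, slot 2 = the η-defect of the ADJOINT entry `𝒢∘D^η_{R⁻_{μ₂}}` (the glued propagator RIGHT-composed with the covariant backward derivative along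
`τ_{μ₂}⁻¹` — the print's `G∇*_U`), slot 3 = the Laplacian η-defect `𝔇_π̂(Δ′_{U′}G′, Δ_UG)` — 180's three displayed right-hand sides, letter for letter (slots 0, 1, 3 = Σ-F `sfE₄cov`'s).
[cite: Balaban1985BackgroundPropagators, Thm 3.1 (3.42) p.397 (the four entries: shape), (3.50)–(3.53) p.400] -/
def sfE₄adj (hL : Odd L ∧ 1 < L) (μ₁ μ₂ : Fin (d + 1)) (i : SfIdx d L) :
    Fin 4 → (Fin (d + 1) → CvX' d L i.m i.kk i.r hL → Matrix mm mm ℂ) → ((CvX d L i.m i.kk hL × ι → ℝ) →ₗ[ℝ] (CvX' d L i.m i.kk i.r hL × ι → ℝ)) :=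
  fun n A' => ![sfEntry0 d mm ι a e hL i A',
    idef (pull (liftMap (kingPrV L i.kk i.r (cvM d L i.m i.kk hL)) ι)) (pull (liftMap (kingPrV L i.kk i.r (cvM d L i.m i.kk hL)) ι))
        (covD ((((L ^ i.r * L ^ i.kk : ℕ) : ℝ))⁻¹) (gaugePair (bshiftEquiv (cvM d L i.m i.kk hL) (L ^ i.r * L ^ i.kk)) (fun μ x' => coordMat e (ContinuousLinearMap.mulLeftRight ℝ (Matrix mm mm ℂ) (NormedSpace.exp (((((L ^ i.r * L ^ i.kk : ℕ) : ℝ))⁻¹) • A' μ x')) (NormedSpace.exp (((((L ^ i.r * L ^ i.kk : ℕ) : ℝ))⁻¹) • A' μ x'))ᴴ)) (Sum.inl μ₁)) (bshiftEquiv (cvM d L i.m i.kk hL) (L ^ i.r * L ^ i.kk) μ₁) ∘ₗ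
          cvGlued' d L i.m i.kk i.r hL a ((((L ^ i.r * L ^ i.kk : ℕ) : ℝ))⁻¹) ι e (fun _ _ => (1 : Matrix mm mm ℂ)) (fun μ x' => NormedSpace.exp (((((L ^ i.r * L ^ i.kk : ℕ) : ℝ))⁻¹) • A' μ x')) (cvNL' d L i.m i.kk i.r hL a ι) (fun _ => 0))
        (covD ((((L ^ i.kk : ℕ) : ℝ))⁻¹) (gaugePair (bshiftEquiv (cvM d L i.m i.kk hL) (L ^ i.kk)) (fun μ x => coordMat e (ContinuousLinearMap.mulLeftRight ℝ (Matrix mm mm ℂ) (NormedSpace.exp (((((L ^ i.kk : ℕ) : ℝ))⁻¹) • gavgM (Matrix mm mm ℂ) (Fin (d + 1)) (kingPrV L i.kk i.r (cvM d L i.m i.kk hL)) A' μ x)) (NormedSpace.exp (((((L ^ i.kk : ℕ) : ℝ))⁻¹) • gavgM (Matrix mm mm ℂ) (Fin (d + 1)) (kingPrV L i.kk i.r (cvM d L i.m i.kk hL)) A' μ x))ᴴ)) (Sum.inl μ₁)) (bshiftEquiv (cvM d L i.m i.kk hL) (L ^ i.kk) μ₁) ∘ₗ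
          cvGlued d L i.m i.kk hL a ((((L ^ i.kk : ℕ) : ℝ))⁻¹) ι e (fun _ _ => (1 : Matrix mm mm ℂ)) (fun μ x => NormedSpace.exp (((((L ^ i.kk : ℕ) : ℝ))⁻¹) • gavgM (Matrix mm mm ℂ) (Fin (d + 1)) (kingPrV L i.kk i.r (cvM d L i.m i.kk hL)) A' μ x)) (cvNL d L i.m i.kk hL a ι) (fun _ => 0)),
    idef (pull (liftMap (kingPrV L i.kk i.r (cvM d L i.m i.kk hL)) ι)) (pull (liftMap (kingPrV L i.kk i.r (cvM d L i.m i.kk hL)) ι))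
        ((cvGlued' d L i.m i.kk i.r hL a ((((L ^ i.r * L ^ i.kk : ℕ) : ℝ))⁻¹) ι e (fun _ _ => (1 : Matrix mm mm ℂ)) (fun μ x' => NormedSpace.exp (((((L ^ i.r * L ^ i.kk : ℕ) : ℝ))⁻¹) • A' μ x')) (cvNL' d L i.m i.kk i.r hL a ι) (fun _ => 0)) ∘ₗ covD ((((L ^ i.r * L ^ i.kk : ℕ) : ℝ))⁻¹) ((gaugePair (bshiftEquiv (cvM d L i.m i.kk hL) (L ^ i.r * L ^ i.kk)) (fun μ x' => coordMat e (ContinuousLinearMap.mulLeftRight ℝ (Matrix mm mm ℂ) (NormedSpace.exp (((((L ^ i.r * L ^ i.kk : ℕ) : ℝ))⁻¹) • A' μ x')) (NormedSpace.exp (((((L ^ i.r * L ^ i.kk : ℕ) : ℝ))⁻¹) • A' μ x'))ᴴ))) (Sum.inr μ₂)) ((bshiftEquiv (cvM d L i.m i.kk hL) (L ^ i.r * L ^ i.kk)) μ₂).symm)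
        ((cvGlued d L i.m i.kk hL a ((((L ^ i.kk : ℕ) : ℝ))⁻¹) ι e (fun _ _ => (1 : Matrix mm mm ℂ)) (fun μ x => NormedSpace.exp (((((L ^ i.kk : ℕ) : ℝ))⁻¹) • gavgM (Matrix mm mm ℂ) (Fin (d + 1)) (kingPrV L i.kk i.r (cvM d L i.m i.kk hL)) A' μ x)) (cvNL d L i.m i.kk hL a ι) (fun _ => 0)) ∘ₗ covD ((((L ^ i.kk : ℕ) : ℝ))⁻¹) ((gaugePair (bshiftEquiv (cvM d L i.m i.kk hL) (L ^ i.kk)) (fun μ x => coordMat e (ContinuousLinearMap.mulLeftRight ℝ (Matrix mm mm ℂ) (NormedSpace.exp (((((L ^ i.kk : ℕ) : ℝ))⁻¹) • gavgM (Matrix mm mm ℂ) (Fin (d + 1)) (kingPrV L i.kk i.r (cvM d L i.m i.kk hL)) A' μ x)) (NormedSpace.exp (((((L ^ i.kk : ℕ) : ℝ))⁻¹) • gavgM (Matrix mm mm ℂ) (Fin (d + 1)) (kingPrV L i.kk i.r (cvM d L i.m i.kk hL)) A' μ x))ᴴ))) (Sum.inr μ₂)) ((bshiftEquiv (cvM d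 L i.m i.kk hL) (L ^ i.kk)) μ₂).symm),
    idef (pull (liftMap (kingPrV L i.kk i.r (cvM d L i.m i.kk hL)) ι)) (pull (liftMap (kingPrV L i.kk i.r (cvM d L i.m i.kk hL)) ι)) ((covLapM (bshiftEquiv (cvM d L i.m i.kk hL) (L ^ i.r * L ^ i.kk)) ((((L ^ i.r * L ^ i.kk : ℕ) : ℝ))⁻¹) (gaugePair (bshiftEquiv (cvM d L i.m i.kk hL) (L ^ i.r * L ^ i.kk)) (fun μ x' => coordMat e (ContinuousLinearMap.mulLeftRight ℝ (Matrix mm mm ℂ) (NormedSpace.exp (((((L ^ i.r * L ^ i.kk : ℕ) : ℝ))⁻¹) • A' μ x')) (NormedSpace.exp (((((L ^ i.r * L ^ i.kk : ℕ) : ℝ))⁻¹) • A' μ x'))ᴴ)))) ∘ₗ (cvGlued' d L i.m i.kk i.r hL a ((((L ^ i.r * L ^ i.kk : ℕ) : ℝ))⁻¹) ι e (fun _ _ => (1 : Matrix mm mm ℂ)) (fun μ x' => NormedSpace.exp (((((L ^ i.r * L ^ i.kk : ℕ) : ℝ))⁻¹) • A' μ x')) (cvNL' d L i.m i.kk i.r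 hL a ι) (fun _ => 0))) ((covLapM (bshiftEquiv (cvM d L i.m i.kk hL) (L ^ i.kk)) ((((L ^ i.kk : ℕ) : ℝ))⁻¹) (gaugePair (bshiftEquiv (cvM d L i.m i.kk hL) (L ^ i.kk)) (fun μ x => coordMat e (ContinuousLinearMap.mulLeftRight ℝ (Matrix mm mm ℂ) (NormedSpace.exp (((((L ^ i.kk : ℕ) : ℝ))⁻¹) • gavgM (Matrix mm mm ℂ) (Fin (d + 1)) (kingPrV L i.kk i.r (cvM d L i.m i.kk hL)) A' μ x)) (NormedSpace.exp (((((L ^ i.kk : ℕ) : ℝ))⁻¹) • gavgM (Matrix mm mm ℂ) (Fin (d + 1)) (kingPrV L i.kk i.r (cvM d L i.m i.kk hL)) A' μ x))ᴴ)))) ∘ₗ (cvGlued d L i.m i.kk hL a ((((L ^ i.kk : ℕ) : ℝ))⁻¹) ι e (fun _ _ => (1 : Matrix mm mm ℂ)) (fun μ x => NormedSpace.exp (((((L ^ i.kk : ℕ) : ℝ))⁻¹) • gavgM (Matrix mm mm ℂ) (Fin (d + 1)) (kingPrV L i.kk i.r (cvM d L i.m i.kk hL)) A' μ x)) (cvNL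 d L i.m i.kk hL a ι) (fun _ => 0)))] n

set_option maxRecDepth 4096 in
/-- Slot 0 of `sfE₄adj` is Σ-F's slot 0 (n15-c's `sfEntry0`). [bookkeeping] -/
theorem sfE₄adj_zero (hL : Odd L ∧ 1 < L) (μ₁ μ₂ : Fin (d + 1)) (i : SfIdx d L) : sfE₄adj d mm ι a e hL μ₁ μ₂ i 0 = sfE₄cov d mm ι a e hL μ₁ μ₂ i 0 := rfl

set_option maxRecDepth 4096 in
/-- Slot 1 of `sfE₄adj` is Σ-F's slot 1 (the covariant forward gradient entry at `μ₁`). [bookkeeping] -/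
theorem sfE₄adj_one (hL : Odd L ∧ 1 < L) (μ₁ μ₂ : Fin (d + 1)) (i : SfIdx d L) : sfE₄adj d mm ι a e hL μ₁ μ₂ i 1 = sfE₄cov d mm ι a e hL μ₁ μ₂ i 1 := rfl

set_option maxRecDepth 4096 in
/-- Slot 3 of `sfE₄adj` is Σ-F's slot 3 (the Laplacian entry). [bookkeeping] -/
theorem sfE₄adj_three (hL : Odd L ∧ 1 < L) (μ₁ μ₂ : Fin (d + 1)) (i : SfIdx d L) : sfE₄adj d mm ι a e hL μ₁ μ₂ i 3 = sfE₄cov d mm ι a e hL μ₁ μ₂ i 3 := rfl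

set_option maxHeartbeats 400000 in
set_option maxRecDepth 4096 in
/-- ★★★ **n15-c∕180's FOUR-ENTRY OPERATOR LAYER WITH THE PRINTED ENTRY 2, EQUATION-FREE**: `NE2PlusOperator c₃₅ (sfInstance d mm ι hL) (fun i => sfFamily d mm ι a e hL i (sfE₄adj d mm ι a e hL μ₁ μ₂ i))`
— n15-c∕180 `ne2PlusOperator_sf₄_adj` fed with the concrete assignment (`hE1 hE2 hE3 := rfl`); hypotheses = odd `L ≥ 7`, `a, c₃₅ > 0`, trace-form-orthonormal `e` only; rate exponent
`γ = 1∕(16(d+1))` inside.  n15-c's theorem; this line only removes the displayed equations. [cite: Balaban1985BackgroundPropagators, Thm 3.1 (3.42) p.397 (quantifier template; `G∇*_U`); Thm 3.14 pp.426–427 (difference template)] -/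
theorem ne2PlusOperator_sf₄adj (hL : Odd L ∧ 1 < L) (hL7 : 7 ≤ L) {a : ℝ} (ha : 0 < a) {c35 : ℝ} (hc35 : 0 < c35) (he : ∀ A B : Matrix mm mm ℂ, traceForm A B = e A ⬝ᵥ e B)
    (μ₁ μ₂ : Fin (d + 1)) :
    NE2PlusOperator c35 (sfInstance d mm ι hL) (fun i => sfFamily d mm ι a e hL i (sfE₄adj d mm ι a e hL μ₁ μ₂ i)) :=
  ne2PlusOperator_sf₄_adj d mm ι e hL hL7 ha hc35 he μ₁ μ₂ (sfE₄adj d mm ι a e hL μ₁ μ₂) (fun _ _ => rfl) (fun _ _ => rfl) (fun _ _ => rfl)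

/-! ## §2 The closed literal; `Live ∧ N15At`; keyed face -/

/-- **THE CLOSED ROAD-(c) LITERAL WITH THE PRINTED ENTRY 2**: Σ-E's `sfObjects` at the concrete entry assignment `sfE₄adj … μ₁ μ₂` (slot 2 = the adjoint arrangement `𝒢∘∇^{U*}`). [bookkeeping] -/
def sfObjects₄adj (hL : Odd L ∧ 1 < L) (μ₁ μ₂ : Fin (d + 1)) (c35 p aS : ℝ) (α β : Fin (d + 1)) : NE2Objects₁₁ :=
  sfObjects d mm ι a e hL (sfE₄adj d mm ι a e hL μ₁ μ₂) c35 p aS α β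

/-- Unfolding (`rfl`). [bookkeeping] -/
theorem sfObjects₄adj_eq (hL : Odd L ∧ 1 < L) (μ₁ μ₂ : Fin (d + 1)) (c35 p aS : ℝ) (α β : Fin (d + 1)) :
    sfObjects₄adj d mm ι a e hL μ₁ μ₂ c35 p aS α β = sfObjects d mm ι a e hL (sfE₄adj d mm ι a e hL μ₁ μ₂) c35 p aS α β := rfl

/-- ★★★ **GUARD ∧ `N15At` AT THE CLOSED LITERAL OF n15-c's LIVE FAMILY** — `d ≥ 1`, odd `L ≥ 7`, `a, c₃₅, a_S > 0`, trace-form-orthonormal `e`, directions `μ₁ μ₂ α β`, any `p`: the node's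
three conjuncts BY NAME + dag-n15-w2's guard, the OPERATOR layer reading the matrix potential `A′` (`U = e^{η′A′}`) in all four (3.42) entries — entry 2 in the PRINTED adjoint arrangement `𝒢∘∇^{U*}` (n15-c∕180) —,
NO displayed equation or majorant hypothesis. [cite: Balaban1985BackgroundPropagators, Thm 3.1 (3.42) p.397, Thm 3.2 (3.48) p.398, Thm 3.15 (3.187) p.432 (quantifier templates); King1986, Lemma 4.5 (4.38) p.674 (A = 0 template)] -/
theorem live_and_n15At_sfObjects₄adj (hd : 1 ≤ d) (hL : Odd L ∧ 1 < L) (hL7 : 7 ≤ L) {a : ℝ} (ha : 0 < a) {c35 : ℝ} (hc35 : 0 < c35)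
    (he : ∀ A B : Matrix mm mm ℂ, traceForm A B = e A ⬝ᵥ e B) (μ₁ μ₂ : Fin (d + 1)) {aS : ℝ} (haS : 0 < aS) (α β : Fin (d + 1)) (p : ℝ) :
    Live (ne2OfRecord₁₁ (sfObjects₄adj d mm ι a e hL μ₁ μ₂ c35 p aS α β)) ∧ N15At (ne2OfRecord₁₁ (sfObjects₄adj d mm ι a e hL μ₁ μ₂ c35 p aS α β)) :=
  live_and_n15At_sf_of_ne2PlusOperator d mm ι a e hd hL.1 (by omega) hL haS α β hc35.le p _ (ne2PlusOperator_sf₄adj d mm ι e hL hL7 ha hc35 he μ₁ μ₂)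

/-- ★★ `N15At` at the closed literal. [bookkeeping] -/
theorem n15At_sfObjects₄adj (hd : 1 ≤ d) (hL : Odd L ∧ 1 < L) (hL7 : 7 ≤ L) {a : ℝ} (ha : 0 < a) {c35 : ℝ} (hc35 : 0 < c35)
    (he : ∀ A B : Matrix mm mm ℂ, traceForm A B = e A ⬝ᵥ e B) (μ₁ μ₂ : Fin (d + 1)) {aS : ℝ} (haS : 0 < aS) (α β : Fin (d + 1)) (p : ℝ) :
    N15At (ne2OfRecord₁₁ (sfObjects₄adj d mm ι a e hL μ₁ μ₂ c35 p aS α β)) :=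
  (live_and_n15At_sfObjects₄adj d mm ι e hd hL hL7 ha hc35 he μ₁ μ₂ haS α β p).2

/-- ★★ the closed literal is LIVE (`c₃₅ ≥ 0`). [bookkeeping] -/
theorem live_sfObjects₄adj (hL : Odd L ∧ 1 < L) (μ₁ μ₂ : Fin (d + 1)) {c35 : ℝ} (hc35 : 0 ≤ c35) (p aS : ℝ) (α β : Fin (d + 1)) :
    Live (ne2OfRecord₁₁ (sfObjects₄adj d mm ι a e hL μ₁ μ₂ c35 p aS α β)) :=
  live_sfObjects d mm ι a e hL hc35 p aS α β _

variable {N : ℕ} [NeZero N] {key : (F : T4Family) → YMDAG.UVSplit.Datum F N → Prop}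

/-- ★★ **THE CLOSED LITERAL AT ANY KEYED HOME** (part 30's interface): a rate home over ANY key admitting only the literals of a key-indexed NE2 reading whose value everywhere is
`sfObjects₄adj …` has `S_N15 RRec` (`d ≥ 1`, odd `L ≥ 7`, `a, c₃₅, a_S > 0`, trace-form-orthonormal `e`). [bookkeeping] -/
theorem s_N15_of_admits_sf₄adj (hd : 1 ≤ d) (hL : Odd L ∧ 1 < L) (hL7 : 7 ≤ L) {a : ℝ} (ha : 0 < a) {c35 : ℝ} (hc35 : 0 < c35)
    (he : ∀ A B : Matrix mm mm ℂ, traceForm A B = e A ⬝ᵥ e B) (μ₁ μ₂ : Fin (d + 1)) {aS : ℝ} (haS : 0 < aS) (α β : Fin (d + 1)) (p : ℝ)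
    (ne2At : ∀ {F : T4Family} {D : YMDAG.UVSplit.Datum F N}, key F D → (ℕ → ℝ) → List (ULoop F) → ℕ → NE2Objects₁₁) (RRec : YMDAG.UVSplit.RateRecordPred N)
    (hadm : ∀ (F : T4Family) (D : YMDAG.UVSplit.Datum F N) (g₀ : ℕ → ℝ) (os : List (ULoop F)) (R : YMDAG.UVSplit.RateCarriers N), RRec F D g₀ os R →
      ∃ (h : key F D) (k : ℕ), R.ne2 = ne2OfRecord₁₁ (ne2At h g₀ os k))
    (h : ∀ (F : T4Family) (D : YMDAG.UVSplit.Datum F N) (h : key F D) (g₀ : ℕ → ℝ) (os : List (ULoop F)) (k : ℕ), ne2At h g₀ os k = sfObjects₄adj d mm ι a e hL μ₁ μ₂ c35 p aS α β) :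
    YMDAG.UVSplit.S_N15 RRec :=
  s_N15_of_admits ne2At RRec hadm fun F D hk g₀ os k => by
    rw [h F D hk g₀ os k]; exact n15At_sfObjects₄adj d mm ι e hd hL hL7 ha hc35 he μ₁ μ₂ haS α β p


/-! ## §3 The family-keyed editions (`(d, L) := (3, F.L)`; `7 ≤ F.L` from `F.hL11`, Σ-F `seven_le_blockFactor`) and the road-(c) pinned faces under the pin BODY -/


/-- ★★ **GUARD ∧ `N15At` AT THE FAMILY-KEYED CLOSED LITERAL** (`(d, L) := (3, F.L)`; `a, c₃₅, a_S > 0`, trace-form-orthonormal `e`, directions `μ₁ μ₂ α β : Fin 4`). [bookkeeping] -/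
theorem live_and_n15At_sfObjects₄adj_family (F : T4Family) {a : ℝ} (ha : 0 < a) {c35 : ℝ} (hc35 : 0 < c35)
    (he : ∀ A B : Matrix mm mm ℂ, traceForm A B = e A ⬝ᵥ e B) (μ₁ μ₂ : Fin 4) {aS : ℝ} (haS : 0 < aS) (α β : Fin 4) (p : ℝ) :
    haveI := neZero_blockFactor F
    Live (ne2OfRecord₁₁ (sfObjects₄adj 3 mm ι a e F.hL μ₁ μ₂ c35 p aS α β)) ∧ N15At (ne2OfRecord₁₁ (sfObjects₄adj 3 mm ι a e F.hL μ₁ μ₂ c35 p aS α β)) := by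
  haveI := neZero_blockFactor F
  exact live_and_n15At_sfObjects₄adj 3 mm ι e (by norm_num) F.hL (seven_le_blockFactor F) ha hc35 he μ₁ μ₂ haS α β p

variable {N' : ℕ} [NeZero N']

/-- ★★ **PINNED TO n15-c's CLOSED ADJOINT-ENTRY LITERAL ⟹ KEYED-LIVE, EVERY SELECTOR** (road-(c) drop-in; pin BODY = «for some colour data `mm ι e` with a trace-form-orthonormal `e`, letters
`a, c₃₅, a_S > 0`, directions, `p`, the reading's NE2 objects ARE `sfObjects₄adj 3 mm ι a e F.hL …` at every tuple and run length»). [bookkeeping] -/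
theorem keyedLive_of_pinnedSf₄adj (𝔯 : RateReading₁₃CoPH N')
    (hpin : ∃ (mm ι : Type) (_ : Fintype mm) (_ : DecidableEq mm) (_ : Fintype ι) (_ : DecidableEq ι) (a : ℝ) (e : Matrix mm mm ℂ ≃L[ℝ] (ι → ℝ))
      (μ₁ μ₂ α β : Fin 4) (c35 p aS : ℝ), (∀ A B : Matrix mm mm ℂ, traceForm A B = e A ⬝ᵥ e B) ∧ 0 < a ∧ 0 < c35 ∧ 0 < aS ∧
      ∀ (F : T4Family) (θ : Stage13HParams F N') (hP : θ.Provisos₁₃CoPH F N') (g₀ : ℕ → ℝ) (os : List (ULoop F)) (k : ℕ),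
        (𝔯.lit F θ hP g₀ os).ne2 k = haveI := neZero_blockFactor F; sfObjects₄adj 3 mm ι a e F.hL μ₁ μ₂ c35 p aS α β)
    (ksel : (F : T4Family) → (θ : Stage13HParams F N') → θ.Provisos₁₃CoPH F N' → (ℕ → ℝ) → List (ULoop F) → ℕ) :
    KeyedLive (fun F θ hP g₀ os => rateCarriersOfRecord₁₃CoPH 𝔯 F θ hP g₀ os (ksel F θ hP g₀ os)) := by
  obtain ⟨mm, ι, _, _, _, _, a, e, μ₁, μ₂, α, β, c35, p, aS, he, ha, hc35, haS, h⟩ := hpin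
  intro F θ hP _ _ g₀ os
  show Live (ne2OfRecord₁₁ ((𝔯.lit F θ hP g₀ os).ne2 (ksel F θ hP g₀ os)))
  rw [h F θ hP g₀ os (ksel F θ hP g₀ os)]
  exact (live_and_n15At_sfObjects₄adj_family mm ι e F ha hc35 he μ₁ μ₂ haS α β p).1

/-- ★★★ **PINNED TO n15-c's CLOSED ADJOINT-ENTRY LITERAL ⟹ `Live ∧ N15At` AT EVERY BUNDLE OF RECORD** (every Stage-13 parameter with provisos, every `(g₀, os)`, every selector) — the road-(c) twin of
S-C §5 ∕ Σ-B ∕ Σ-D: N15's decl of record at every reading a v8 pin to n15-c's family would name, the OPERATOR layer NON-ABELIAN-live. [bookkeeping] -/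
theorem live_and_n15At_rrOfRecord_of_pinnedSf₄adj (𝔯 : RateReading₁₃CoPH N')
    (hpin : ∃ (mm ι : Type) (_ : Fintype mm) (_ : DecidableEq mm) (_ : Fintype ι) (_ : DecidableEq ι) (a : ℝ) (e : Matrix mm mm ℂ ≃L[ℝ] (ι → ℝ))
      (μ₁ μ₂ α β : Fin 4) (c35 p aS : ℝ), (∀ A B : Matrix mm mm ℂ, traceForm A B = e A ⬝ᵥ e B) ∧ 0 < a ∧ 0 < c35 ∧ 0 < aS ∧
      ∀ (F : T4Family) (θ : Stage13HParams F N') (hP : θ.Provisos₁₃CoPH F N') (g₀ : ℕ → ℝ) (os : List (ULoop F)) (k : ℕ),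
        (𝔯.lit F θ hP g₀ os).ne2 k = haveI := neZero_blockFactor F; sfObjects₄adj 3 mm ι a e F.hL μ₁ μ₂ c35 p aS α β)
    (ksel : (F : T4Family) → (θ : Stage13HParams F N') → θ.Provisos₁₃CoPH F N' → (ℕ → ℝ) → List (ULoop F) → ℕ)
    (F : T4Family) (θ : Stage13HParams F N') (hP : θ.Provisos₁₃CoPH F N') (g₀ : ℕ → ℝ) (os : List (ULoop F)) :
    Live (rateCarriersOfRecord₁₃CoPH 𝔯 F θ hP g₀ os (ksel F θ hP g₀ os)).ne2 ∧ N15At (rateCarriersOfRecord₁₃CoPH 𝔯 F θ hP g₀ os (ksel F θ hP g₀ os)).ne2 := by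
  obtain ⟨mm, ι, _, _, _, _, a, e, μ₁, μ₂, α, β, c35, p, aS, he, ha, hc35, haS, h⟩ := hpin
  show Live (ne2OfRecord₁₁ ((𝔯.lit F θ hP g₀ os).ne2 (ksel F θ hP g₀ os))) ∧ N15At (ne2OfRecord₁₁ ((𝔯.lit F θ hP g₀ os).ne2 (ksel F θ hP g₀ os)))
  rw [h F θ hP g₀ os (ksel F θ hP g₀ os)]
  exact live_and_n15At_sfObjects₄adj_family mm ι e F ha hc35 he μ₁ μ₂ haS α β p

/-- ★★ **PINNED ⟹ `N15At` AT EVERY RUN LENGTH** of the reading's literal. [bookkeeping] -/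
theorem n15At_lit_of_pinnedSf₄adj (𝔯 : RateReading₁₃CoPH N')
    (hpin : ∃ (mm ι : Type) (_ : Fintype mm) (_ : DecidableEq mm) (_ : Fintype ι) (_ : DecidableEq ι) (a : ℝ) (e : Matrix mm mm ℂ ≃L[ℝ] (ι → ℝ))
      (μ₁ μ₂ α β : Fin 4) (c35 p aS : ℝ), (∀ A B : Matrix mm mm ℂ, traceForm A B = e A ⬝ᵥ e B) ∧ 0 < a ∧ 0 < c35 ∧ 0 < aS ∧
      ∀ (F : T4Family) (θ : Stage13HParams F N') (hP : θ.Provisos₁₃CoPH F N') (g₀ : ℕ → ℝ) (os : List (ULoop F)) (k : ℕ),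
        (𝔯.lit F θ hP g₀ os).ne2 k = haveI := neZero_blockFactor F; sfObjects₄adj 3 mm ι a e F.hL μ₁ μ₂ c35 p aS α β)
    (F : T4Family) (θ : Stage13HParams F N') (hP : θ.Provisos₁₃CoPH F N') (g₀ : ℕ → ℝ) (os : List (ULoop F)) (k : ℕ) :
    N15At (ne2OfRecord₁₁ ((𝔯.lit F θ hP g₀ os).ne2 k)) := by
  obtain ⟨mm, ι, _, _, _, _, a, e, μ₁, μ₂, α, β, c35, p, aS, he, ha, hc35, haS, h⟩ := hpin
  rw [h F θ hP g₀ os k]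
  exact (live_and_n15At_sfObjects₄adj_family mm ι e F ha hc35 he μ₁ μ₂ haS α β p).2

end Summit.QuantumFields.YangMills.BalabanUVNodes.N15.GenuineRecord

end
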